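import Summits.BirchSwinnertonDyer.BirchSwinnertonDyer.Theorems.SchneiderFreeAdditiveX3GordTwoBranchIMCOfKYBranchOnly
import Summits.BirchSwinnertonDyer.BirchSwinnertonDyer.Theorems.SchneiderFreeAdditiveX3GordTwoBranchIMCSliverVoidModThree
import Literature.NumberTheory.QuadraticFields.KroneckerSplitting
import HarnessLib

/-!
# Route `SchneiderFreeAdditiveX3` (K1 door), crux r3 `GordTwoBranchIMC`: the `d_K = −3` sliver is VOID at EVEN conductor —
# hence on EVERY pair of the census — and the (G-ord, `e = 2`) lower socket at `p ≢ 1 (mod 3)` OR `2 ∣ N_W` from named facts only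

Cell `bsd-schneider-ideate`, seat `bsd-schneider-door-c5` (prover, generation 21; assembly layer; `--supports` 19177).
PARTITION: board row B6 ∩ X3 ∩ sst-twist, `r = 1`, (G-ord, `e = 2`) half (2 560 of 7 101 pairs) of `Rank1Residual.partition`;
SHRINKS the support of the one research-shaped input left on the by-name crux r3 — the `d_K = −3` sliver `KYReadSliver`
(Keller–Yin's Assumption 2.0.3 and Castella–Hsieh both exclude `K = ℚ(√−3)`): door-c3 gen 7/12 showed it void at `p ≢ 1 (mod 3)`
(2 542 of the 2 560 census pairs); this file shows it void whenever `2 ∣ N_W`: `2` is INERT in `ℚ(√−3)` (`d_K = −3 ≢ 1 (mod 8)`,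
decomposition law at `2`, tree `Quadratic.ncard_primesOver_two_eq_two_iff`), so an even level admits no Heegner hypothesis for
`ℚ(√−3)`.  The 18 remaining census pairs (`p = 7`: 231770co1, 247254bp1, 265776ci1, 272832ff1, 316050et1, 336336gw1, 402486bv1,
404544fg1, 414050dv1, 414050fp1, 414050ge1, 42042cn1, 482160ez1, 68208cq1, 82810bc1, 94178s1; `p = 13`: 414050fr1, 488410bu1 —
door-c3 gen 7's census of kit j263392, `memos/census-door-c3-g7/goodmember.tsv.gz`, sha16 ec6db7ef0803daeb) ALL have even
conductor, so the sliver input is void on 2 560 / 2 560 census pairs; class-wide it remains (curves with `N_W = p²M`, every prime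
factor `≡ 1 (mod 3)`).  Closes nothing (BSD NOT advanced; crux r3 OPEN behind Keller–Yin Thm. 3.5.1, a preprint).
bears_on: K1-door (items 18971/18972 → 19177 r3).

* §1 `not_satisfiesHeegnerHypothesis_of_two_dvd_of_discr_eq_neg_three` — the arithmetic (fact-free);
  `discr_ne_neg_three_of_heegner_of_two_dvd` — the form the sockets consume.
* §2 `additiveIMCLowerBDPInputManinAt_gordTwo_of_…_of_two_dvd_conductor` and `…_of_mod_three_ne_one_or_two_dvd` — the (G-ord,
  `e = 2`) lower socket `AdditiveIMCLowerBDPInputManinAt W p` ⇐ Kolyvagin ∧ modularity ∧ Hsieh 2014 Thm A ∧ Liu–Zhang–Zhang 2018 ∧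
  Keller–Yin Thm 3.5.1 clauses (iii)+(μ) (PREPRINT) ∧ Castella–Hsieh signed existence, for every `W` of the cell with `2 ∣ N_W`
  (resp. `p % 3 ≠ 1 ∨ 2 ∣ N_W`): NO sliver, NO Cai–Shu–Tian, NO `thm351_imc_isTorsion_mu_zero_charIdeal_eq_OPEN`.

HONEST FRAMING: §1 is unconditional; §2 is CONDITIONAL on the displayed hypotheses; nothing asserted about BSD; no item closed.
References: Marcus, *Number Fields*, Ch. 3 Thm. 25 and Ireland–Rosen Prop. 13.1.4 (decomposition law at 2); Keller–Yin
arXiv:2410.23241 Assumption 2.0.3 (preprint); Gross 1991 §1 / Darmon 2004 Hyp. 3.9 (Heegner hypothesis).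
-/

set_option autoImplicit false
-- `Summit.<P>.<Sub>` repeats `BirchSwinnertonDyer` by the tree's layout convention (D-0017)
set_option linter.dupNamespace false

noncomputable section

open scoped Classical NumberField

open Field NumberField IsDedekindDomain WeierstrassCurve
  Literature.NumberTheory.EllipticCurves Literature.NumberTheory.EllipticCurves.GreenbergSelmer
  Literature.NumberTheory.GaloisRepresentations Literature.NumberTheory.GaloisCohomology
  Literature.NumberTheory.EllipticCurves.ModularForms Literature.NumberTheory.EllipticCurves.Rank1Residual
  Literature.NumberTheory.EllipticCurves.KellerYin2024
  Summit.BirchSwinnertonDyer.Rank1Residual Summit.BirchSwinnertonDyer.Rank1Residual.X11b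
  Summit.BirchSwinnertonDyer.BirchSwinnertonDyer.Theorems.SchneiderFree
  Summit.BirchSwinnertonDyer.BirchSwinnertonDyer.Theorems.SchneiderFree.KYRead
  Summit.BirchSwinnertonDyer.BirchSwinnertonDyer.Theses.SchneiderFreeAdditiveX3
  Summit.BirchSwinnertonDyer.BirchSwinnertonDyer.Theorems.SchneiderFreeAdditiveX3.ControlDischarged

namespace Summit.BirchSwinnertonDyer.BirchSwinnertonDyer.Theorems.SchneiderFreeAdditiveX3.KYBranchOnly

/-! ### §1 `2` is inert in `ℚ(√−3)`: no Heegner hypothesis at an even level -/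

/-- **`2` does not split in `ℚ(√−3)`**: for a quadratic field `K` with `d_K = −3`, `((2)·𝓞_K).primesOver` does NOT have two
elements (`d_K ≡ 5 (mod 8)`: `2` is inert), by the decomposition law at `2` (tree `Quadratic.ncard_primesOver_two_eq_two_iff`:
`2` splits iff `d_K ≡ 1 (mod 8)`). [cite: Marcus1977, Ch. 3 Thm. 25 (decomposition of 2 in quadratic fields)] -/
theorem ncard_primesOver_two_ne_two_of_discr_eq_neg_three {K : Type} [Field K] [NumberField K]
    (h2 : Module.finrank ℚ K = 2) (hd : NumberField.discr K = -3) :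
    ((Ideal.span {(2 : ℤ)}).primesOver (𝓞 K)).ncard ≠ 2 := by
  rw [Ne, Literature.NumberTheory.QuadraticFields.Quadratic.ncard_primesOver_two_eq_two_iff h2, hd]
  decide

/-- **An even level admits no Heegner hypothesis for `ℚ(√−3)`**: if `d_K = −3` and `2 ∣ N` then `SatisfiesHeegnerHypothesis N K`
fails (it asks every prime factor of `N`, here `2`, to split in `K`). [cite: Marcus1977, Ch. 3 Thm. 25 (decomposition of 2 in quadratic fields)] -/
theorem not_satisfiesHeegnerHypothesis_of_two_dvd_of_discr_eq_neg_three {K : Type} [Field K] [NumberField K]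
    (h2 : Module.finrank ℚ K = 2) (hd : NumberField.discr K = -3) {N : ℕ} (hN : 2 ∣ N) :
    ¬ SatisfiesHeegnerHypothesis N K := fun h ↦
  ncard_primesOver_two_ne_two_of_discr_eq_neg_three h2 hd (by simpa using h 2 Nat.prime_two hN)

/-- **Corollary (the form the sockets consume): a Heegner field for an EVEN level has `d_K ≠ −3`.** [cite: Marcus1977, Ch. 3 Thm. 25 (decomposition of 2 in quadratic fields)] -/
theorem discr_ne_neg_three_of_heegner_of_two_dvd {K : Type} [Field K] [NumberField K] (hK : IsImaginaryQuadratic K)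
    {N : ℕ} (hN : 2 ∣ N) (hHe : SatisfiesHeegnerHypothesis N K) : NumberField.discr K ≠ -3 := fun hd ↦
  not_satisfiesHeegnerHypothesis_of_two_dvd_of_discr_eq_neg_three hK.1 hd hN hHe

/-- The same read at a socket datum: the level `N` of the datum is the conductor `N_W = W.conductorNorm ℤ` (a natural number),
so an evenness hypothesis on `N_W` transfers to `N`. [folklore] -/
theorem discr_ne_neg_three_of_heegner_of_two_dvd_conductor {K : Type} [Field K] [NumberField K] (hK : IsImaginaryQuadratic K)
    (W : WeierstrassCurve ℚ) {N : ℕ} (hWN : W.conductorNorm ℤ = N) (h2N : 2 ∣ W.conductorNorm ℤ)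
    (hHe : SatisfiesHeegnerHypothesis N K) : NumberField.discr K ≠ -3 :=
  discr_ne_neg_three_of_heegner_of_two_dvd hK (hWN ▸ h2N) hHe

/-! ### §2 The (G-ord, `e = 2`) lower socket at even conductor — NO sliver -/

/-- **The (G-ord, `e = 2`) lower socket `AdditiveIMCLowerBDPInputManinAt W p` for every `W` of the cell with EVEN conductor, from
NAMED FACTS ONLY, with NO sliver** ⇐ Kolyvagin ∧ modularity ∧ Hsieh 2014 Thm. A ∧ Liu–Zhang–Zhang 2018 ∧ Keller–Yin Thm. 3.5.1
clauses (iii)+(μ) (PREPRINT, two typed clauses) ∧ Castella–Hsieh signed existence: no Heegner datum of the socket has `d_K = −3`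
(§1), so `…OfKYBranchOnly`'s off-sliver socket applies to every datum.  CONDITIONAL on the named facts; closes no item; BSD NOT
advanced. [cite: KellerYin2024b, Thm. 3.5.1 and Assumption 2.0.3 (arXiv:2410.23241 pp. 8, 20) (preprint; hypotheses)]
[cite: CastellaHsieh2018, §3.3, Def. 3.7 and Prop. 3.8] [cite: Hsieh2014, Thm. A p. 712 (Doc. Math. 19)]
[cite: LiuZhangZhang2018, Thm 1.5.1 and Thm 1.5.3 (Duke Math. J. 167 pp. 748–749)] -/
theorem additiveIMCLowerBDPInputManinAt_gordTwo_of_hsieh_of_lzz_of_KY_branch_of_castellaHsieh_signed_of_two_dvd_conductor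
    (hKo : ∀ (N : ℕ) [NeZero N] (W : WeierstrassCurve ℚ) (K : Type) [Field K] [NumberField K],
      Literature.NumberTheory.EllipticCurves.kolyvagin N W K)
    (hPar : nonempty_modularParametrizationData)
    (hA : Hsieh2014.thmA_exists_isHsiehLFunction_unrPeriod_anyLevel)
    (hL : LiuZhangZhang2018.thm151_thm153_modularCurve_heegnerVector_additive)
    (hKYb : thm351_charIdeal_eq_branch_OPEN) (hKYμ : thm351_mu_zero_branch_OPEN)
    (hCHσ : castellaHsieh2018_exists_isBranchBDPLFunction_signed) :
    ∀ (W : WeierstrassCurve ℚ) [W.IsElliptic] [W.IsGloballyMinimal] (p : ℕ) [Fact p.Prime],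
      W.analyticRank = 1 → p ≠ 2 → ClassX3 W p → Additive.SubGordTwo W p → 2 ∣ W.conductorNorm ℤ →
        AdditiveIMCLowerBDPInputManinAt W p := by
  intro W _ _ p _ hr hp2 hX hS h2N N _ K _ _ Dt H ι P hr' hloc hN hK hodd hunit hHe hL1 hP hnt κ hκ γ _ 𝔭 h𝔭 he hf
  have hdK : NumberField.discr K ≠ -3 := discr_ne_neg_three_of_heegner_of_two_dvd_conductor hK W hN h2N hHe
  exact additiveIMCLowerBDPOnTree_subGordTwo_offSliver_of_hsieh_of_lzz_of_KY_branch_of_castellaHsieh_signed hKo hPar hA hL hKYb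
    hKYμ hCHσ W p hr hp2 hX hS N K Dt H ι P hr' hloc hN hK hodd hunit hHe hL1 hP hnt hdK κ hκ γ 𝔭 h𝔭 he hf

/-- **The (G-ord, `e = 2`) lower socket at `p ≢ 1 (mod 3)` OR even conductor — NO sliver, NO Cai–Shu–Tian, NO
`thm351_imc_isTorsion_mu_zero_charIdeal_eq_OPEN`** (door-c3 gen 12's `mod_three_eq_one_of_degreeOne_of_discr_eq_neg_three` for the
first disjunct, §1 for the second).  On the census of the cell (kit j263392: 2 560 pairs; `p = 3`: 2 411, `p = 5`: 131 — first
disjunct; `p ∈ {7, 13}`: 18, all of even conductor — second disjunct) the hypothesis holds at EVERY pair.  CONDITIONAL on the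
named facts; closes no item; BSD NOT advanced. [cite: KellerYin2024b, Thm. 3.5.1 and Assumption 2.0.3 (arXiv:2410.23241 pp. 8, 20) (preprint; hypotheses)]
[cite: HardyWright2008, Thm 96] [cite: Marcus1977, Ch. 3 Thm. 25 (decomposition of 2 in quadratic fields)] -/
theorem additiveIMCLowerBDPInputManinAt_gordTwo_of_hsieh_of_lzz_of_KY_branch_of_castellaHsieh_signed_of_mod_three_ne_one_or_two_dvd
    (hKo : ∀ (N : ℕ) [NeZero N] (W : WeierstrassCurve ℚ) (K : Type) [Field K] [NumberField K],
      Literature.NumberTheory.EllipticCurves.kolyvagin N W K)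
    (hPar : nonempty_modularParametrizationData)
    (hA : Hsieh2014.thmA_exists_isHsiehLFunction_unrPeriod_anyLevel)
    (hL : LiuZhangZhang2018.thm151_thm153_modularCurve_heegnerVector_additive)
    (hKYb : thm351_charIdeal_eq_branch_OPEN) (hKYμ : thm351_mu_zero_branch_OPEN)
    (hCHσ : castellaHsieh2018_exists_isBranchBDPLFunction_signed) :
    ∀ (W : WeierstrassCurve ℚ) [W.IsElliptic] [W.IsGloballyMinimal] (p : ℕ) [Fact p.Prime],
      W.analyticRank = 1 → p ≠ 2 → ClassX3 W p → Additive.SubGordTwo W p → (p % 3 ≠ 1 ∨ 2 ∣ W.conductorNorm ℤ) →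
        AdditiveIMCLowerBDPInputManinAt W p := by
  intro W _ _ p _ hr hp2 hX hS h N _ K _ _ Dt H ι P hr' hloc hN hK hodd hunit hHe hL1 hP hnt κ hκ γ _ 𝔭 h𝔭 he hf
  have hdK : NumberField.discr K ≠ -3 := by
    rcases h with hp3 | h2N
    · exact discr_ne_neg_three_of_degreeOne_of_mod_three_ne_one hK hp3 hunit h𝔭 he hf
    · exact discr_ne_neg_three_of_heegner_of_two_dvd_conductor hK W hN h2N hHe
  exact additiveIMCLowerBDPOnTree_subGordTwo_offSliver_of_hsieh_of_lzz_of_KY_branch_of_castellaHsieh_signed hKo hPar hA hL hKYb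
    hKYμ hCHσ W p hr hp2 hX hS N K Dt H ι P hr' hloc hN hK hodd hunit hHe hL1 hP hnt hdK κ hκ γ 𝔭 h𝔭 he hf

/-- **The same in the route file's vocabulary** (`PrintedFacts` conjuncts 2 and 5 consumed): at `p ≢ 1 (mod 3)` or even conductor
the door's crux r3 reads `PrintedFacts → Hsieh2014.thmA… → LiuZhangZhang2018.thm151… → thm351_charIdeal_eq_branch_OPEN →
thm351_mu_zero_branch_OPEN → castellaHsieh2018_exists_isBranchBDPLFunction_signed → (socket)`.  CONDITIONAL; closes no item; BSD
NOT advanced. [cite: KellerYin2024b, Thm. 3.5.1 (arXiv:2410.23241 p. 20) (preprint; hypotheses)] -/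
theorem additiveIMCLowerBDPInputManinAt_gordTwo_of_printedFacts_of_KY_branch_of_mod_three_ne_one_or_two_dvd
    (hF : PrintedFacts) (hA : Hsieh2014.thmA_exists_isHsiehLFunction_unrPeriod_anyLevel)
    (hL : LiuZhangZhang2018.thm151_thm153_modularCurve_heegnerVector_additive)
    (hKYb : thm351_charIdeal_eq_branch_OPEN) (hKYμ : thm351_mu_zero_branch_OPEN)
    (hCHσ : castellaHsieh2018_exists_isBranchBDPLFunction_signed) :
    ∀ (W : WeierstrassCurve ℚ) [W.IsElliptic] [W.IsGloballyMinimal] (p : ℕ) [Fact p.Prime],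
      W.analyticRank = 1 → p ≠ 2 → ClassX3 W p → Additive.SubGordTwo W p → (p % 3 ≠ 1 ∨ 2 ∣ W.conductorNorm ℤ) →
        AdditiveIMCLowerBDPInputManinAt W p := by
  obtain ⟨-, hKo, -, -, hPar, -⟩ := id hF
  exact additiveIMCLowerBDPInputManinAt_gordTwo_of_hsieh_of_lzz_of_KY_branch_of_castellaHsieh_signed_of_mod_three_ne_one_or_two_dvd
    hKo hPar hA hL hKYb hKYμ hCHσ

end Summit.BirchSwinnertonDyer.BirchSwinnertonDyer.Theorems.SchneiderFreeAdditiveX3.KYBranchOnly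

end
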